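import Summits.CriticalPhenomena.PercolationContinuityZ3.Theorems.Transplant.AutPolynomialGrowthEndState
import Summits.CriticalPhenomena.PercolationContinuityZ3.Theorems.Transplant.HeisenbergCriticalProbLtOne
import Summits.CriticalPhenomena.PercolationContinuityZ3.Theorems.Transplant.AutChartNodeNormalForm
import HarnessLib

/-!
# What the planners' END-STATE node (multi-type frames, quasi-steps) would buy: Conjecture 4 for EVERY quasi-transitive graph of
# polynomial growth (modulo Trofimov's theorem); the chain Conj. 4 ⟹ end-state continuity ⟹ `U_s`

builds on p205010 (kernel theorem, internal audit signed; external expert review pending) — nothing in this file uses p205010.  Conditional on the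
NAMED FACT `Trofimov1985_polynomialGrowthBlocks` (hypothesis `hT`) and on the explicit hypothesis `hE` = END-STATE CONTINUITY, an OPEN statement of
this programme (never asserted): "`θ_x(p_c) = 0` at every vertex of every connected locally finite graph carrying a subgroup `A₀ ≤ Aut(G)` with
finitely many orbits and a homomorphism `A₀ → ℤ²` of rank-two image killing every vertex stabiliser" — the conclusion a multi-type / quasi-step
frames node would deliver (P4-GENERAL §41.5/§43.2/§49); it contains the one-type conditional theorem's class.  Lane `prim-bschramm`, seat
`prim-bschramm-p4` gen 27.  Helper file (`--supports stmt-CriticalPhenomena-4575 --as helper`).  Def-free (the named form of `hE` belongs in a Defs file).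
* **`AutPoly.conj4_polynomialGrowth_of_endState`** — `hE` + `hT` ⟹ `BenjaminiSchramm1996_conj4_polynomialGrowth`: Conjecture 4 for EVERY
  quasi-transitive graph of polynomial growth, no exception class (the `vb₁ ≥ 2 > b₁` wall, hcp, pts, every 3- and 4-coordinated net, every Cayley
  graph of every virtually nilpotent group), through `AutPoly.exists_finiteOrbits_rankTwo`; `heisenberg_of_endState` spells out the Heisenberg instance
  (every other `_of_conj4_polynomialGrowth` reduction of the tree — fcc, bcc, hcp, stacked triangular, films, `ℤ³` alphabets, Barlow stackings —
  follows the same way).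
* **`endState_of_conj4`** — sanity: the end-state class is quasi-transitive with `p_c < 1` (gen 25's UNCONDITIONAL
  `AutChart.criticalProb_lt_one_of_finite_orbits`), so Conjecture 4 implies end-state continuity.
* **`frmScaledNode₁_of_endState`** — end-state continuity implies the open one-type node `U_s` (`SamePDropOfSkeletonFrmScaled₁`, through its
  chart-free normal form `AutChart.frmScaledNode₁_iff_autChart`).
So: Conj. 4 ⟹ end-state continuity ⟹ `U_s`, and end-state continuity + Trofimov ⟹ Conj. 4 on polynomial growth.  WHAT REMAINS after such a
node, exactly: quasi-transitive graphs of INTERMEDIATE growth (where `Aut(G)` need not virtually surject onto a rank-two subgroup of `ℤ²`: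
torsion groups, gen 26), the site versions, and the node itself.  Nothing is claimed about any open node.
[cite: BenjaminiSchramm1996, Conj. 4; §2 (almost transitive graphs); Conj. 1; Thm. 1] [cite: Trofimov1985, Thm. 2] [cite: HermonHutchcroft2021, §1]
[cite: KozmaNitzan2024, §4 p. 16 (Lemma 8)]
-/

noncomputable section

namespace Summit.CriticalPhenomena.PercolationContinuityZ3.Theorems.Transplant

open SimpleGraph Filter Literature.Barriers.CriticalPhenomena Literature.Probability.LatticeModels Literature.Probability.Percolation
open Literature.Combinatorics.SimpleGraph (Trofimov1985_polynomialGrowthBlocks)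
open scoped Classical

namespace AutPoly

/-! ## §2 What the END-STATE node would buy: Conjecture 4 for EVERY quasi-transitive graph of polynomial growth (modulo Trofimov) -/

/-- **COROLLARY (the payoff of the planners' end-state node, kernel modulo Trofimov's theorem).**  Call END-STATE CONTINUITY the statement
"`θ_x(p_c) = 0` at every vertex of every connected locally finite graph carrying a subgroup `A₀ ≤ Aut(G)` with finitely many orbits and a
homomorphism `A₀ → ℤ²` of rank-two image killing every vertex stabiliser" (the hypothesis `hE`; it is what a multi-type / quasi-step frames
node would deliver, P4-GENERAL §41.5, and it contains the one-type conditional theorem's class).  THEN Benjamini–Schramm's Conjecture 4 holds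
for EVERY quasi-transitive graph of polynomial growth (`BenjaminiSchramm1996_conj4_polynomialGrowth`): no polynomial-growth case is left —
the Heisenberg group, hcp, every periodic net, every Cayley graph of every virtually nilpotent group, the `vb₁ ≥ 2 > b₁` wall included.
[cite: BenjaminiSchramm1996, Conj. 4; §2 (almost transitive graphs)] [cite: Trofimov1985, Thm. 2] [cite: HermonHutchcroft2021, §1] -/
theorem conj4_polynomialGrowth_of_endState (hT : Trofimov1985_polynomialGrowthBlocks)
    (hE : ∀ {W : Type} (G' : SimpleGraph W) [G'.LocallyFinite], G'.Connected →
      ∀ (A₀ : Subgroup (G' ≃g G')) (reps : Finset W) (c : A₀ →* Multiplicative (Site 2)),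
        (∀ w : W, ∃ a : A₀, ∃ s ∈ reps, (a : G' ≃g G') s = w) → (∀ (a : A₀) (w : W), (a : G' ≃g G') w = w → c a = 1) →
        (∃ a b : A₀, MaxArea.det2 (Multiplicative.toAdd (c a)) (Multiplicative.toAdd (c b)) ≠ 0) →
          ∀ x : W, theta G' x (criticalProbIOf G' x) = 0) :
    BenjaminiSchramm1996_conj4_polynomialGrowth := by
  intro W G' _ hc hq hpoly x hpc
  obtain ⟨A₀, reps, c, horb, hstab, hrank⟩ := exists_finiteOrbits_rankTwo hT hc hq hpoly hpc
  exact hE G' hc A₀ reps c horb hstab hrank x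

/-- **… in particular `θ(p_c) = 0` on the Cayley graph of the discrete Heisenberg group** (the lane's first class-C2 instance,
`HeisenbergCriticalContinuity`) would follow from end-state continuity and Trofimov's theorem — as would every other polynomial-growth
instance statement of the tree with a `_of_conj4_polynomialGrowth` reduction (fcc, bcc, hcp, stacked triangular, oblique films, tall and
unit generating sets of `ℤ³`, Barlow stackings, the Heisenberg GRR). [cite: BenjaminiSchramm1996, Conj. 4] [cite: Trofimov1985, Thm. 2] -/
theorem heisenberg_of_endState (hT : Trofimov1985_polynomialGrowthBlocks)
    (hE : ∀ {W : Type} (G' : SimpleGraph W) [G'.LocallyFinite], G'.Connected →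
      ∀ (A₀ : Subgroup (G' ≃g G')) (reps : Finset W) (c : A₀ →* Multiplicative (Site 2)),
        (∀ w : W, ∃ a : A₀, ∃ s ∈ reps, (a : G' ≃g G') s = w) → (∀ (a : A₀) (w : W), (a : G' ≃g G') w = w → c a = 1) →
        (∃ a b : A₀, MaxArea.det2 (Multiplicative.toAdd (c a)) (Multiplicative.toAdd (c b)) ≠ 0) →
          ∀ x : W, theta G' x (criticalProbIOf G' x) = 0) :
    HeisenbergCriticalContinuity :=
  heisenbergCriticalContinuity_of_conj4_polynomialGrowth' (conj4_polynomialGrowth_of_endState hT hE)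

/-- **On the polynomial-growth class the end-state input is EQUIVALENT to `p_c < 1`** (⟸: `exists_finiteOrbits_rankTwo`, modulo Trofimov;
⟹: gen 25's unconditional `AutChart.criticalProb_lt_one_of_finite_orbits`) — so there it is exactly Benjamini–Schramm's proviso, equivalently
superlinear growth. [cite: BenjaminiSchramm1996, Conj. 4 ("assuming p_c < 1"); §2 Conj. 1] [cite: Trofimov1985, Thm. 2] -/
theorem exists_finiteOrbits_rankTwo_iff (hT : Trofimov1985_polynomialGrowthBlocks) {V : Type} {G : SimpleGraph V} [G.LocallyFinite]
    (hc : G.Connected) (hq : IsQuasiTransitive G) (hpoly : ∃ C D : ℝ, ∀ (x : V) (n : ℕ), (ballVolume G x n : ℝ) ≤ C * ((n : ℝ) + 1) ^ D) (v : V) :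
    (∃ (A₀ : Subgroup (G ≃g G)) (reps : Finset V) (c : A₀ →* Multiplicative (Site 2)),
      (∀ w : V, ∃ a : A₀, ∃ s ∈ reps, (a : G ≃g G) s = w) ∧ (∀ (a : A₀) (w : V), (a : G ≃g G) w = w → c a = 1) ∧
      ∃ a b : A₀, MaxArea.det2 (Multiplicative.toAdd (c a)) (Multiplicative.toAdd (c b)) ≠ 0) ↔ criticalProb G v < 1 := by
  refine ⟨fun ⟨A₀, reps, c, horb, hstab, hrank⟩ => ?_, fun h => exists_finiteOrbits_rankTwo hT hc hq hpoly h⟩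
  have hact : IsActionByAut G A₀ := fun a y z => (a : G ≃g G).map_rel_iff'
  exact AutChart.criticalProb_lt_one_of_finite_orbits hact hc v reps (fun w => by
    obtain ⟨a, s, hs, hw⟩ := horb w; exact ⟨a, s, hs, hw⟩) c (fun a ha => hstab a v (MulAction.mem_stabilizer_iff.1 ha)) hrank v

/-- **SANITY (the end-state class lies inside Conjecture 4's scope): Conjecture 4 ⟹ end-state continuity** — a graph with such an `A₀` is
quasi-transitive and has `p_c < 1` at every vertex (gen 25's UNCONDITIONAL `AutChart.criticalProb_lt_one_of_finite_orbits`).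
[cite: BenjaminiSchramm1996, Conj. 4; §2 Conj. 1; Thm. 1] -/
theorem endState_of_conj4 (h : BenjaminiSchramm1996_conj4) {W : Type} (G' : SimpleGraph W) [G'.LocallyFinite] (hc : G'.Connected)
    (A₀ : Subgroup (G' ≃g G')) (reps : Finset W) (c : A₀ →* Multiplicative (Site 2))
    (horb : ∀ w : W, ∃ a : A₀, ∃ s ∈ reps, (a : G' ≃g G') s = w) (hstab : ∀ (a : A₀) (w : W), (a : G' ≃g G') w = w → c a = 1)
    (hrank : ∃ a b : A₀, MaxArea.det2 (Multiplicative.toAdd (c a)) (Multiplicative.toAdd (c b)) ≠ 0) (x : W) :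
    theta G' x (criticalProbIOf G' x) = 0 := by
  have hact : IsActionByAut G' A₀ := fun a y z => (a : G' ≃g G').map_rel_iff'
  have hq : IsQuasiTransitive G' := ⟨reps, fun w => by
    obtain ⟨a, s, hs, hw⟩ := horb w
    refine ⟨(a : G' ≃g G')⁻¹, ?_⟩
    rw [← hw, RelIso.inv_apply_self]
    exact hs⟩
  have hlt : criticalProb G' x < 1 :=
    AutChart.criticalProb_lt_one_of_finite_orbits hact hc x reps (fun w => by
      obtain ⟨a, s, hs, hw⟩ := horb w; exact ⟨a, s, hs, hw⟩) c
      (fun a ha => hstab a x (MulAction.mem_stabilizer_iff.1 ha)) hrank x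
  exact h G' hc hq x hlt

/-- **End-state continuity implies the open one-type node `U_s`** (`SamePDropOfSkeletonFrmScaled₁`, through its chart-free normal form
`AutChart.frmScaledNode₁_iff_autChart`): a transitive subgroup translating a rank-two chart is an end-state datum with ONE orbit, the
character being the translation character.  So the chain reads: Conj. 4 ⟹ end-state continuity ⟹ `U_s`, and end-state continuity + Trofimov
⟹ Conj. 4 for polynomial growth. [cite: BenjaminiSchramm1996, Conj. 4] [cite: KozmaNitzan2024, §4 p. 16 (Lemma 8)] -/
theorem frmScaledNode₁_of_endState
    (hE : ∀ {W : Type} (G' : SimpleGraph W) [G'.LocallyFinite], G'.Connected →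
      ∀ (A₀ : Subgroup (G' ≃g G')) (reps : Finset W) (c : A₀ →* Multiplicative (Site 2)),
        (∀ w : W, ∃ a : A₀, ∃ s ∈ reps, (a : G' ≃g G') s = w) → (∀ (a : A₀) (w : W), (a : G' ≃g G') w = w → c a = 1) →
        (∃ a b : A₀, MaxArea.det2 (Multiplicative.toAdd (c a)) (Multiplicative.toAdd (c b)) ≠ 0) →
          ∀ x : W, theta G' x (criticalProbIOf G' x) = 0) :
    SamePDropOfSkeletonFrmScaled₁ := by
  refine AutChart.frmScaledNode₁_iff_autChart.2 ?_
  intro W _ _ G' _ hc _ t hA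
  obtain ⟨A, φ, htr, hφ, hrank⟩ := hA
  have hact : IsActionByAut G' A := fun a y z => (a : G' ≃g G').map_rel_iff'
  -- the translation character of the chart on the subgroup type
  let c : A →* Multiplicative (Site 2) := AutChart.chartHom (A := A) t φ fun a w => hφ a a.2 w
  have hc_apply : ∀ a : A, Multiplicative.toAdd (c a) = φ ((a : G' ≃g G') t) - φ t := fun a => rfl
  refine hE G' hc A {t} c (fun w => ?_) (fun a w haw => ?_) ?_ t
  · obtain ⟨α, hα, hw⟩ := htr w
    exact ⟨⟨α, hα⟩, t, Finset.mem_singleton_self t, hw⟩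
  · have h := hφ a a.2 w
    rw [haw] at h
    rw [← ofAdd_toAdd (c a), hc_apply, ← ofAdd_zero]
    congr 1
    have : φ w = φ w + (φ ((a : G' ≃g G') t) - φ t) := h
    linear_combination -this
  · obtain ⟨x, y, hxy⟩ := hrank
    obtain ⟨α, hα, rfl⟩ := htr x
    obtain ⟨β, hβ, rfl⟩ := htr y
    exact ⟨⟨α, hα⟩, ⟨β, hβ⟩, by rw [hc_apply, hc_apply]; exact hxy⟩

end AutPoly

end Summit.CriticalPhenomena.PercolationContinuityZ3.Theorems.Transplant

end
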